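import Summits.CriticalPhenomena.PercolationContinuityZ3.Theorems.PercNearOneGluingNoHeavyLowerTailBlockGluing
import HarnessLib

/-!
# `NoHeavyLowerTail` (stmt-CriticalPhenomena-4575) — THREE-RELAY EVENT GLUING under the prefix condition

Support file (prover prim-gen-kcluster gen 3; `--supports stmt-CriticalPhenomena-4575`).  No definitions, no sorries.
For an observer `o`, a sink `b` and three relays `a₁, a₂, a₃` with `d₁ ≥ d₂` (`d_i = μ(a_i ↮ b)`) and the PREFIX CONDITION
`μ(a₁ ↮ b, a₂ ↮ b) ≥ d₃` (the two worst relays are jointly cut at least as often as the best one alone; it implies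
`d₂ ≥ d₃`), plus non-degeneracy of the two conditioning events used:

* `worstFirst_three_prefix`: `μ(W₁)/d₁ + μ(W₂)/d₂ + μ(W₃)/d₃ ≤ 1` for the worst-first exit events
  `W₁ = {o↔a₁, a₁↮b}`, `W₂ = {o↔a₂, o↮a₁, a₂↮b}`, `W₃ = {o↔a₃, o↮a₁, o↮a₂, a₃↮b}` — worst-first gluing (WF) for
  three relays in that regime: two applications of the block step (`blockGluing_two` with `S = {a₁}`, then
  `blockWorstFirst_two` with `S = {a₁, a₂}`);
* `eventGluing_three_prefix`: `μ({o ↮ b} ∩ ({o↔a₁} ∪ {o↔a₂} ∪ {o↔a₃})) ≤ d₁` — the three-relay EVENT GLUING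
  inequality (the strong event form of Kozma–Nitzan's additive gluing with constant `1`) in that regime.
The complementary regime `μ(a₁ ↮ b, a₂ ↮ b) < d₃` ("case B", generic when all `d_i` are small) is open; see the seat
report KCLUSTER-gen3.md for the conjectured order-only statements (R1_A), (R1_0), (POT).
-/

noncomputable section

namespace Summit.CriticalPhenomena.PercolationContinuityZ3.Theorems

open MeasureTheory Set Literature.Probability.LatticeModels Literature.Probability.Percolation
open scoped Classical BigOperators
open PathExchange (rs)

namespace BlockStep

variable {V : Type*}

/-- `{∀ s ∈ {a}, s ↮ b} = {a ↮ b}`. [folklore] -/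
theorem sep_singleton (a b : V) :
    {ω : BondConfig V | ∀ s ∈ ({a} : Finset V), ¬ (openGraph ω).Reachable s b} = (openConn a b : Set (BondConfig V))ᶜ := by
  ext ω; simp only [Finset.mem_singleton, forall_eq, mem_setOf_eq, mem_compl_iff, openConn]

/-- `{∀ s ∈ {a₁,a₂}, s ↮ b} = {a₁ ↮ b} ∩ {a₂ ↮ b}`. [folklore] -/
theorem sep_pair (a₁ a₂ b : V) :
    {ω : BondConfig V | ∀ s ∈ ({a₁, a₂} : Finset V), ¬ (openGraph ω).Reachable s b} =
      (openConn a₁ b : Set (BondConfig V))ᶜ ∩ (openConn a₂ b)ᶜ := by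
  ext ω
  simp only [Finset.mem_insert, Finset.mem_singleton, forall_eq_or_imp, forall_eq, mem_setOf_eq, mem_inter_iff,
    mem_compl_iff, openConn]

/-- `⋃_{s ∈ {a}} {x ↔ s} = {x ↔ a}`. [folklore] -/
theorem conn_biUnion_singleton (x a : V) :
    (⋃ s ∈ ({a} : Finset V), (openConn x s : Set (BondConfig V))) = openConn x a :=
  Finset.set_biUnion_singleton a _

/-- `⋃_{s ∈ {a₁,a₂}} {x ↔ s} = {x ↔ a₁} ∪ {x ↔ a₂}`. [folklore] -/
theorem conn_biUnion_pair (x a₁ a₂ : V) :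
    (⋃ s ∈ ({a₁, a₂} : Finset V), (openConn x s : Set (BondConfig V))) = openConn x a₁ ∪ openConn x a₂ := by
  rw [Finset.set_biUnion_insert, Finset.set_biUnion_singleton]

/-- **Worst-first gluing for three relays under the prefix condition (PROVED).** [this file] -/
theorem worstFirst_three_prefix [Fintype V] (w : Sym2 V → unitInterval) (o b a₁ a₂ a₃ : V)
    (h12 : (prodBernoulli w).real (openConn a₂ b : Set (BondConfig V))ᶜ ≤
      (prodBernoulli w).real (openConn a₁ b : Set (BondConfig V))ᶜ)
    (hpre : (prodBernoulli w).real (openConn a₃ b : Set (BondConfig V))ᶜ ≤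
      (prodBernoulli w).real ((openConn a₁ b : Set (BondConfig V))ᶜ ∩ (openConn a₂ b)ᶜ))
    (hL2 : 0 < (prodBernoulli w).real ((openConn a₁ b : Set (BondConfig V))ᶜ ∩ (openConn a₂ b)ᶜ ∩ (openConn a₂ a₁)ᶜ))
    (hL3 : 0 < (prodBernoulli w).real ((openConn a₁ b : Set (BondConfig V))ᶜ ∩ (openConn a₂ b)ᶜ ∩ (openConn a₃ b)ᶜ ∩
      (openConn a₃ a₁ ∪ openConn a₃ a₂)ᶜ)) :
    (prodBernoulli w).real ((openConn o a₁ : Set (BondConfig V)) ∩ (openConn a₁ b)ᶜ) /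
        (prodBernoulli w).real (openConn a₁ b : Set (BondConfig V))ᶜ +
      (prodBernoulli w).real ((openConn o a₂ : Set (BondConfig V)) ∩ (openConn o a₁)ᶜ ∩ (openConn a₂ b)ᶜ) /
        (prodBernoulli w).real (openConn a₂ b : Set (BondConfig V))ᶜ +
      (prodBernoulli w).real ((openConn o a₃ : Set (BondConfig V)) ∩ (openConn o a₁ ∪ openConn o a₂)ᶜ ∩
          (openConn a₃ b)ᶜ) /
        (prodBernoulli w).real (openConn a₃ b : Set (BondConfig V))ᶜ ≤ 1 := by
  -- step 1: merge `{a₁}` with `a₂`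
  have hord2 : (prodBernoulli w).real (openConn a₂ b : Set (BondConfig V))ᶜ ≤
      (prodBernoulli w).real {ω : BondConfig V | ∀ s ∈ ({a₁} : Finset V), ¬ (openGraph ω).Reachable s b} := by
    rw [sep_singleton]; exact h12
  have hL2' : 0 < (prodBernoulli w).real ({ω : BondConfig V | ∀ s ∈ ({a₁} : Finset V),
      ¬ (openGraph ω).Reachable s b} ∩ (openConn a₂ b)ᶜ ∩ (⋃ s ∈ ({a₁} : Finset V),
        (openConn a₂ s : Set (BondConfig V)))ᶜ) := by
    rw [sep_singleton, conn_biUnion_singleton]; exact hL2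
  have step1 := blockGluing_two w ({a₁} : Finset V) o b a₂ hord2 hL2'
  rw [sep_singleton, conn_biUnion_singleton] at step1
  -- step 2: merge `{a₁, a₂}` with `a₃`
  have hord3 : (prodBernoulli w).real (openConn a₃ b : Set (BondConfig V))ᶜ ≤
      (prodBernoulli w).real {ω : BondConfig V | ∀ s ∈ ({a₁, a₂} : Finset V), ¬ (openGraph ω).Reachable s b} := by
    rw [sep_pair]; exact hpre
  have hL3' : 0 < (prodBernoulli w).real ({ω : BondConfig V | ∀ s ∈ ({a₁, a₂} : Finset V),
      ¬ (openGraph ω).Reachable s b} ∩ (openConn a₃ b)ᶜ ∩ (⋃ s ∈ ({a₁, a₂} : Finset V),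
        (openConn a₃ s : Set (BondConfig V)))ᶜ) := by
    rw [sep_pair, conn_biUnion_pair]; exact hL3
  have step2 := blockWorstFirst_two w ({a₁, a₂} : Finset V) o b a₃ hord3 hL3'
  rw [sep_pair, conn_biUnion_pair] at step2
  -- glue: the right-hand side of step 1 is the first term of step 2
  linarith [step1, step2]

/-- **Three-relay event gluing under the prefix condition (PROVED).**  With the hypotheses of
`worstFirst_three_prefix`:  `μ({o ↮ b} ∩ ({o↔a₁} ∪ {o↔a₂} ∪ {o↔a₃})) ≤ μ(a₁ ↮ b) = max_i μ(a_i ↮ b)`. [this file] -/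
theorem eventGluing_three_prefix [Fintype V] (w : Sym2 V → unitInterval) (o b a₁ a₂ a₃ : V)
    (h12 : (prodBernoulli w).real (openConn a₂ b : Set (BondConfig V))ᶜ ≤
      (prodBernoulli w).real (openConn a₁ b : Set (BondConfig V))ᶜ)
    (hpre : (prodBernoulli w).real (openConn a₃ b : Set (BondConfig V))ᶜ ≤
      (prodBernoulli w).real ((openConn a₁ b : Set (BondConfig V))ᶜ ∩ (openConn a₂ b)ᶜ))
    (hL2 : 0 < (prodBernoulli w).real ((openConn a₁ b : Set (BondConfig V))ᶜ ∩ (openConn a₂ b)ᶜ ∩ (openConn a₂ a₁)ᶜ))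
    (hL3 : 0 < (prodBernoulli w).real ((openConn a₁ b : Set (BondConfig V))ᶜ ∩ (openConn a₂ b)ᶜ ∩ (openConn a₃ b)ᶜ ∩
      (openConn a₃ a₁ ∪ openConn a₃ a₂)ᶜ)) :
    (prodBernoulli w).real ((openConn o b : Set (BondConfig V))ᶜ ∩ (openConn o a₁ ∪ openConn o a₂ ∪ openConn o a₃)) ≤
      (prodBernoulli w).real (openConn a₁ b : Set (BondConfig V))ᶜ := by
  set μ := prodBernoulli w with hμ
  set W₁ : Set (BondConfig V) := (openConn o a₁ : Set (BondConfig V)) ∩ (openConn a₁ b)ᶜ with hW₁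
  set W₂ : Set (BondConfig V) := (openConn o a₂ : Set (BondConfig V)) ∩ (openConn o a₁)ᶜ ∩ (openConn a₂ b)ᶜ with hW₂
  set W₃ : Set (BondConfig V) := (openConn o a₃ : Set (BondConfig V)) ∩ (openConn o a₁ ∪ openConn o a₂)ᶜ ∩
    (openConn a₃ b)ᶜ with hW₃
  set d₁ := μ.real (openConn a₁ b : Set (BondConfig V))ᶜ with hd₁
  set d₂ := μ.real (openConn a₂ b : Set (BondConfig V))ᶜ with hd₂
  set d₃ := μ.real (openConn a₃ b : Set (BondConfig V))ᶜ with hd₃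
  have hΨ : μ.real W₁ / d₁ + μ.real W₂ / d₂ + μ.real W₃ / d₃ ≤ 1 :=
    worstFirst_three_prefix w o b a₁ a₂ a₃ h12 hpre hL2 hL3
  -- cover: `{o↮b} ∩ ⋃ {o↔a_i} ⊆ W₁ ∪ W₂ ∪ W₃`
  have hcover : ((openConn o b : Set (BondConfig V))ᶜ ∩ (openConn o a₁ ∪ openConn o a₂ ∪ openConn o a₃)) ⊆
      W₁ ∪ W₂ ∪ W₃ := by
    rintro ω ⟨hob, h⟩
    simp only [mem_compl_iff, openConn, mem_setOf_eq, mem_union] at hob h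
    by_cases h1 : (openGraph ω).Reachable o a₁
    · exact Or.inl (Or.inl ⟨h1, fun h1b => hob (h1.trans h1b)⟩)
    by_cases h2 : (openGraph ω).Reachable o a₂
    · exact Or.inl (Or.inr ⟨⟨h2, h1⟩, fun h2b => hob (h2.trans h2b)⟩)
    have h3 : (openGraph ω).Reachable o a₃ := by tauto
    refine Or.inr ⟨⟨h3, ?_⟩, fun h3b => hob (h3.trans h3b)⟩
    simp only [mem_compl_iff, mem_union, openConn, mem_setOf_eq]; tauto
  have hX : μ.real ((openConn o b : Set (BondConfig V))ᶜ ∩ (openConn o a₁ ∪ openConn o a₂ ∪ openConn o a₃)) ≤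
      μ.real W₁ + μ.real W₂ + μ.real W₃ :=
    (measureReal_mono hcover).trans ((measureReal_union_le _ _).trans
      (add_le_add (measureReal_union_le _ _) le_rfl))
  -- termwise `μ(W_j) ≤ d₁ · (μ(W_j)/d_j)`
  have hd23 : d₃ ≤ d₂ := hpre.trans (measureReal_mono Set.inter_subset_right)
  have term : ∀ (W : Set (BondConfig V)) (d : ℝ), μ.real W ≤ d → 0 ≤ d → d ≤ d₁ →
      μ.real W ≤ d₁ * (μ.real W / d) := by
    intro W d hWd hd0 hdd₁
    rcases eq_or_lt_of_le hd0 with hd | hd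
    · have h0 : μ.real W = 0 := le_antisymm (by rw [hd]; exact hWd) measureReal_nonneg
      rw [h0]; simp
    · rw [mul_div_assoc', le_div_iff₀ hd, mul_comm]
      exact mul_le_mul_of_nonneg_right hdd₁ measureReal_nonneg
  have t1 := term W₁ d₁ (measureReal_mono Set.inter_subset_right) measureReal_nonneg le_rfl
  have t2 := term W₂ d₂ (measureReal_mono Set.inter_subset_right) measureReal_nonneg h12
  have t3 := term W₃ d₃ (measureReal_mono Set.inter_subset_right) measureReal_nonneg (hd23.trans h12)
  have hd₁0 : 0 ≤ d₁ := measureReal_nonneg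
  calc μ.real ((openConn o b : Set (BondConfig V))ᶜ ∩ (openConn o a₁ ∪ openConn o a₂ ∪ openConn o a₃))
      ≤ μ.real W₁ + μ.real W₂ + μ.real W₃ := hX
    _ ≤ d₁ * (μ.real W₁ / d₁) + d₁ * (μ.real W₂ / d₂) + d₁ * (μ.real W₃ / d₃) := by linarith
    _ = d₁ * (μ.real W₁ / d₁ + μ.real W₂ / d₂ + μ.real W₃ / d₃) := by ring
    _ ≤ d₁ * 1 := mul_le_mul_of_nonneg_left hΨ hd₁0
    _ = d₁ := mul_one _

end BlockStep

end Summit.CriticalPhenomena.PercolationContinuityZ3.Theorems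

end
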